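import Literature.NumberTheory.LFunctions.WeilCombTwoPointDiagonal
import Literature.NumberTheory.LFunctions.WeilCombPairDifference
import HarnessLib

/-!
# Node weights of `ζ`-mollified combs, XI: the two-point extraction

Topic `Literature/NumberTheory/LFunctions`.  THE ARITHMETIC SIDE OF THE TWO-POINT COMB: if a
nonnegative weight `c` (Chebyshev bound `A₁`, logarithmic sums within `T₀` of those of `Λ`) satisfies
the comb inequality of the design `δ₁ + δ_p` (`p` prime) —
`∑_{(ℓ,ℓ') ∈ {1,p}²} (E_c - E_Λ)(ℓ,ℓ') ≤ ∑_{(ℓ,ℓ')} V_{ℓℓ'}(1) + R` for the node sums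
`E_f(ℓ,ℓ') = ∑_{n ≤ N} f(n) V_{ℓℓ'}(n)` of a `ζ`-mollified comb with window `h` — then
`(B(0)√p/4) log(1/(4h)) ∑_{n ≤ √(1/(4h)), p ∣ n} c(n)/n ≤ R + Γ (1 + log(1/(4h)) + log N + hM + hN)`
with `Γ` independent of `h, M, N, R`:

* `pair_norm_bound` — `V_{ℓℓ'}(1) ≤ B(0)L(1 + log(1/(4h))) + 8N₀LhM + C₃ + 8N₀Lh`;
* `extraction_algebra` — the linear bookkeeping;
* `two_point_extraction` — the statement above.

Everything is proved; no named facts.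
-/

noncomputable section

open MeasureTheory Set
open scoped ArithmeticFunction.vonMangoldt

namespace Literature.NumberTheory.LFunctions

/-! ## The norm of one pair -/

/-- **`V_{ℓℓ'}(1)` is `O(log(1/h) + hM)`**: under the hypotheses of `node_weight_pair`,
`V_{ℓℓ'}(1) ≤ B(0)L(1 + log(1/(4h))) + 8N₀LhM + C₃ + 8N₀Lh`. [folklore] -/
theorem pair_norm_bound {B B' B'' : ℝ → ℝ} {N₀ N₁ N₂ h : ℝ} {L ℓ ℓ' M : ℕ}
    (hB : ∀ x, HasDerivAt B (B' x) x) (hB' : ∀ x, HasDerivAt B' (B'' x) x)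
    (h0 : ∀ x, |B x| ≤ N₀) (h1 : ∀ x, |B' x| ≤ N₁) (h2 : ∀ x, |B'' x| ≤ N₂)
    (hBs : ∀ x, 2 < |x| → B x = 0) (hB0 : ∀ x, 0 ≤ B x)
    (hL : 1 ≤ L) (hℓ : 1 ≤ ℓ) (hℓL : ℓ ≤ L) (hℓ' : 1 ≤ ℓ') (hℓ'L : ℓ' ≤ L)
    (hh : 0 < h) (hhL : h ≤ 1 / (32 * L)) (hhM : 1 ≤ h * M) (hhM2 : h ^ 2 * M ≤ 1) :
    ∑ k' ∈ Finset.Icc 1 M,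
        (∑ k ∈ Finset.Icc 1 M, B ((Real.log (((1 : ℕ) : ℝ) * ℓ' * k' / ℓ) - Real.log k) / h) / Real.sqrt k)
          / Real.sqrt k' / Real.sqrt ((1 : ℕ) : ℝ)
      ≤ B 0 * L * (1 + Real.log (1 / (4 * h))) + 8 * N₀ * L * h * M
        + (8 * ((N₀ + 2 * N₁ + N₂) * (96 + 192 * L) * L ^ 2) * L + 64 * N₀ * L ^ 2)
        + 8 * N₀ * L * h := by
  have hN₀ : 0 ≤ N₀ := (abs_nonneg _).trans (h0 0)
  have hLR : (1 : ℝ) ≤ L := by exact_mod_cast hL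
  have hℓR : (1 : ℝ) ≤ ℓ := by exact_mod_cast hℓ
  have hℓLR : (ℓ : ℝ) ≤ L := by exact_mod_cast hℓL
  have hℓ'R : (1 : ℝ) ≤ ℓ' := by exact_mod_cast hℓ'
  have hℓ'LR : (ℓ' : ℝ) ≤ L := by exact_mod_cast hℓ'L
  have h32 : 1 / (32 * (L : ℝ)) ≤ 1 / 32 := one_div_le_one_div_of_le (by norm_num) (by linarith)
  have hh4 : h ≤ 1 / 4 := by linarith
  have hnode := node_weight_pair (n := 1) hB hB' h0 h1 h2 hBs hB0 hL hℓ hℓL hℓ' hℓ'L le_rfl hh hhL hhM hhM2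
  have hup := (abs_le.1 hnode).2
  simp only [Nat.cast_one, div_one, one_mul] at hup
  -- the diagonal main term
  have hB00 : 0 ≤ B 0 := hB0 0
  have hmS : B 0 * (Real.sqrt ℓ / Real.sqrt ℓ') ≤ B 0 * L := by
    refine mul_le_mul_of_nonneg_left ?_ hB00
    have h1' : Real.sqrt (ℓ : ℝ) ≤ L := by rw [Real.sqrt_le_left (by linarith)]; nlinarith
    have h2' : 1 ≤ Real.sqrt (ℓ' : ℝ) := by rw [Real.le_sqrt' one_pos]; simpa using hℓ'R
    calc Real.sqrt ℓ / Real.sqrt ℓ' ≤ Real.sqrt ℓ / 1 :=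
          div_le_div_of_nonneg_left (Real.sqrt_nonneg _) one_pos h2'
      _ ≤ L := by rw [div_one]; exact h1'
  have hY8 : 8 ≤ 1 / (4 * h) := by
    rw [le_div_iff₀ (by positivity)]
    have : h ≤ 1 / 32 := by linarith
    linarith
  have hlogY : 0 ≤ Real.log (1 / (4 * h)) := Real.log_nonneg (by linarith)
  have hD : ∑ k' ∈ Finset.Icc 1 ⌊1 / (4 * h) / (1 * (ℓ' : ℝ))⌋₊, (if ℓ ∣ 1 * ℓ' * k' then 1 / (k' : ℝ) else 0)
      ≤ 1 + Real.log (1 / (4 * h)) := by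
    calc ∑ k' ∈ Finset.Icc 1 ⌊1 / (4 * h) / (1 * (ℓ' : ℝ))⌋₊, (if ℓ ∣ 1 * ℓ' * k' then 1 / (k' : ℝ) else 0)
        ≤ ∑ k' ∈ Finset.Icc 1 ⌊1 / (4 * h) / (1 * (ℓ' : ℝ))⌋₊, 1 / (k' : ℝ) := by
          refine Finset.sum_le_sum fun k' _ ↦ ?_
          split_ifs
          · exact le_rfl
          · positivity
      _ ≤ 1 + Real.log (⌊1 / (4 * h) / (1 * (ℓ' : ℝ))⌋₊ : ℕ) := LevinsonSums.sum_Icc_one_div_le _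
      _ ≤ 1 + Real.log (1 / (4 * h)) := by
          rcases Nat.eq_zero_or_pos ⌊1 / (4 * h) / (1 * (ℓ' : ℝ))⌋₊ with hz | hpos
          · rw [hz]; simp only [Nat.cast_zero, Real.log_zero, add_zero]; linarith
          · have : Real.log (⌊1 / (4 * h) / (1 * (ℓ' : ℝ))⌋₊ : ℕ) ≤ Real.log (1 / (4 * h)) := by
              apply Real.log_le_log (by exact_mod_cast hpos)
              calc (⌊1 / (4 * h) / (1 * (ℓ' : ℝ))⌋₊ : ℝ) ≤ 1 / (4 * h) / (1 * (ℓ' : ℝ)) :=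
                    Nat.floor_le (by positivity)
                _ ≤ 1 / (4 * h) := div_le_self (by positivity) (by linarith)
            linarith
  have hD0 : 0 ≤ ∑ k' ∈ Finset.Icc 1 ⌊1 / (4 * h) / (1 * (ℓ' : ℝ))⌋₊,
      (if ℓ ∣ 1 * ℓ' * k' then 1 / (k' : ℝ) else 0) :=
    Finset.sum_nonneg fun k' _ ↦ by split_ifs <;> positivity
  have hmain1 : B 0 * (Real.sqrt ℓ / Real.sqrt ℓ') *
      ∑ k' ∈ Finset.Icc 1 ⌊1 / (4 * h) / (1 * (ℓ' : ℝ))⌋₊, (if ℓ ∣ 1 * ℓ' * k' then 1 / (k' : ℝ) else 0)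
      ≤ B 0 * L * (1 + Real.log (1 / (4 * h))) :=
    mul_le_mul hmS hD hD0 (by positivity)
  -- the smooth main term
  have hβ0 : 0 ≤ ∫ v, B v * Real.exp (-(h * v) / 2) := toothBeta_nonneg hB0 h
  have hβ8 : ∫ v, B v * Real.exp (-(h * v) / 2) ≤ 8 * N₀ := toothBeta_le hB0 h0 hBs hh.le hh4
  have hratio : Real.sqrt ℓ' / Real.sqrt ℓ ≤ L := by
    have h1' : Real.sqrt (ℓ' : ℝ) ≤ L := by rw [Real.sqrt_le_left (by linarith)]; nlinarith
    have h2' : 1 ≤ Real.sqrt (ℓ : ℝ) := by rw [Real.le_sqrt' one_pos]; simpa using hℓR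
    calc Real.sqrt ℓ' / Real.sqrt ℓ ≤ Real.sqrt ℓ' / 1 :=
          div_le_div_of_nonneg_left (Real.sqrt_nonneg _) one_pos h2'
      _ ≤ L := by rw [div_one]; exact h1'
  have hmD : h * (∫ v, B v * Real.exp (-(h * v) / 2)) * (Real.sqrt ℓ' / Real.sqrt ℓ) ≤ 8 * N₀ * L * h := by
    calc h * (∫ v, B v * Real.exp (-(h * v) / 2)) * (Real.sqrt ℓ' / Real.sqrt ℓ) ≤ h * (8 * N₀) * L :=
          mul_le_mul (mul_le_mul_of_nonneg_left hβ8 hh.le) hratio (by positivity) (by positivity)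
      _ = 8 * N₀ * L * h := by ring
  have hNn : (((min M ⌊(ℓ : ℝ) * M * Real.exp (-(2 * h)) / ((ℓ' : ℝ) * 1)⌋₊
      - ⌊1 / (4 * h) / (1 * (ℓ' : ℝ))⌋₊ : ℕ) : ℝ)) ≤ M := by
    have : (min M ⌊(ℓ : ℝ) * M * Real.exp (-(2 * h)) / ((ℓ' : ℝ) * 1)⌋₊
        - ⌊1 / (4 * h) / (1 * (ℓ' : ℝ))⌋₊ : ℕ) ≤ M := le_trans (Nat.sub_le _ _) (min_le_left _ _)
    exact_mod_cast this
  have hmain2 : h * (∫ v, B v * Real.exp (-(h * v) / 2)) * (Real.sqrt ℓ' / Real.sqrt ℓ) *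
      (((min M ⌊(ℓ : ℝ) * M * Real.exp (-(2 * h)) / ((ℓ' : ℝ) * 1)⌋₊
        - ⌊1 / (4 * h) / (1 * (ℓ' : ℝ))⌋₊ : ℕ) : ℝ)) ≤ 8 * N₀ * L * h * M :=
    mul_le_mul hmD hNn (Nat.cast_nonneg _) (by positivity)
  simp only [Nat.cast_one, one_mul, mul_one, Real.sqrt_one, div_one] at hup hmain1 hmain2 ⊢
  linarith

/-! ## The linear bookkeeping -/

/-- **The linear bookkeeping of the two-point extraction.** [folklore] -/
theorem extraction_algebra
    {Ec11 EL11 Ec1p EL1p Ecp1 ELp1 Ecpp ELpp V11 V1p Vp1 Vpp R Δ Vb B0 T₀ sqp pinv LY S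
      G11 G1p Gpp Gp1a Hc HL m11 m1p mp1 mpp : ℝ}
    (hcomb : (Ec11 - EL11) + (Ec1p - EL1p) + (Ecp1 - ELp1) + (Ecpp - ELpp) ≤ V11 + V1p + Vp1 + Vpp + R)
    (hV11 : V11 ≤ Vb) (hV1p : V1p ≤ Vb) (hVp1 : Vp1 ≤ Vb) (hVpp : Vpp ≤ Vb)
    (hd11 : |Ec11 - EL11 - m11 * G11| ≤ Δ) (hd1p : |Ec1p - EL1p - m1p * G1p| ≤ Δ)
    (hdpp : |Ecpp - ELpp - mpp * Gpp| ≤ Δ)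
    (hdp1 : |Ecp1 - ELp1 - mp1 * (pinv * Gp1a + (Hc - HL))| ≤ Δ)
    (hG11 : |G11| ≤ T₀ * (1 + LY)) (hG1p : |G1p| ≤ T₀ * (1 + LY)) (hGpp : |Gpp| ≤ T₀ * (1 + LY))
    (hGp1a : |Gp1a| ≤ T₀ * (1 + LY)) (hHc : LY / 4 * S ≤ Hc) (hHL : HL ≤ 2 * (1 + LY))
    (hB0 : 0 ≤ B0) (hsqp : 1 ≤ sqp) (hpinv0 : 0 ≤ pinv) (hpinv1 : pinv ≤ 1) (hT0 : 0 ≤ T₀)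
    (hLY : 0 ≤ LY)
    (hm11 : 0 ≤ m11) (hm11' : m11 ≤ B0) (hm1p : 0 ≤ m1p) (hm1p' : m1p ≤ B0)
    (hmpp : 0 ≤ mpp) (hmpp' : mpp ≤ B0) (hmp1 : mp1 = B0 * sqp) :
    B0 * sqp / 4 * LY * S ≤ R + 4 * Vb + 4 * Δ + B0 * (1 + LY) * (3 * T₀ + sqp * (T₀ + 2)) := by
  have hTL : 0 ≤ T₀ * (1 + LY) := by positivity
  -- lower bounds for the four diagonal contributions
  have low : ∀ m G : ℝ, 0 ≤ m → m ≤ B0 → |G| ≤ T₀ * (1 + LY) → -(B0 * (T₀ * (1 + LY))) ≤ m * G := by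
    intro m G hm hmB hG
    have h3 : m * (-(T₀ * (1 + LY))) ≤ m * G :=
      mul_le_mul_of_nonneg_left (by linarith [neg_abs_le G]) hm
    have h4 : m * (T₀ * (1 + LY)) ≤ B0 * (T₀ * (1 + LY)) := mul_le_mul_of_nonneg_right hmB hTL
    linarith
  have e11 := low m11 G11 hm11 hm11' hG11
  have e1p := low m1p G1p hm1p hm1p' hG1p
  have epp := low mpp Gpp hmpp hmpp' hGpp
  have ep1 : B0 * sqp * (LY / 4 * S) - B0 * sqp * (T₀ * (1 + LY)) - B0 * sqp * (2 * (1 + LY))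
      ≤ mp1 * (pinv * Gp1a + (Hc - HL)) := by
    rw [hmp1]
    have hBs : 0 ≤ B0 * sqp := by positivity
    have h1 : -(T₀ * (1 + LY)) ≤ pinv * Gp1a := by
      have h3 : pinv * |Gp1a| ≤ 1 * (T₀ * (1 + LY)) := mul_le_mul hpinv1 hGp1a (abs_nonneg _) zero_le_one
      have h4 : pinv * (-|Gp1a|) ≤ pinv * Gp1a := mul_le_mul_of_nonneg_left (neg_abs_le Gp1a) hpinv0
      linarith
    have h2 : LY / 4 * S - T₀ * (1 + LY) - 2 * (1 + LY) ≤ pinv * Gp1a + (Hc - HL) := by linarith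
    have := mul_le_mul_of_nonneg_left h2 hBs
    linarith
  -- the four pair differences from below
  have f11 := (abs_le.1 hd11).1
  have f1p := (abs_le.1 hd1p).1
  have fpp := (abs_le.1 hdpp).1
  have fp1 := (abs_le.1 hdp1).1
  have key : B0 * sqp * (LY / 4 * S) ≤ R + 4 * Vb + 4 * Δ + 3 * (B0 * (T₀ * (1 + LY)))
      + B0 * sqp * (T₀ * (1 + LY)) + B0 * sqp * (2 * (1 + LY)) := by linarith
  have e : R + 4 * Vb + 4 * Δ + 3 * (B0 * (T₀ * (1 + LY))) + B0 * sqp * (T₀ * (1 + LY))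
      + B0 * sqp * (2 * (1 + LY)) = R + 4 * Vb + 4 * Δ + B0 * (1 + LY) * (3 * T₀ + sqp * (T₀ + 2)) := by
    ring
  have e2 : B0 * sqp * (LY / 4 * S) = B0 * sqp / 4 * LY * S := by ring
  linarith

/-! ## The extraction -/

/-- **Two-point extraction.**  Let `B` be a `C²` bump autocorrelation (`B ≥ 0`, supported in
`[-2,2]`, bounds `N₀, N₁, N₂`), `p` prime, `0 < h ≤ 1/(32p)`, `hM ≥ 1`, `h²M ≤ 1`, `N ≥ 1`,
`⌊√(1/(4h))⌋ ≤ N`; let `c ≥ 0` with `∑_{n ≤ N'} c(n) ≤ A₁N'` and `|∑_{n ≤ N'} (c(n)-Λ(n))/n| ≤ T₀`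
for all `N'`.  If the node sums `E_f(ℓ,ℓ') = ∑_{n ≤ N} f(n)V_{ℓℓ'}(n)` of the comb satisfy
`∑_{(ℓ,ℓ') ∈ {1,p}²} (E_c - E_Λ)(ℓ,ℓ') ≤ ∑ V_{ℓℓ'}(1) + R`, then
`(B(0)√p/4) log(1/(4h)) ∑_{n ≤ ⌊√(1/(4h))⌋, p ∣ n} c(n)/n ≤ R + 4V♭ + 4Δ + B(0)(1 + log(1/(4h)))(3T₀ + √p(T₀+2))`
with the explicit `V♭` of `pair_norm_bound` and `Δ` of `pair_difference_bound` (`L = p`). [folklore] -/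
theorem two_point_extraction {B B' B'' : ℝ → ℝ} {N₀ N₁ N₂ A₁ T₀ h R : ℝ} {p M N : ℕ} {c : ℕ → ℝ}
    (hB : ∀ x, HasDerivAt B (B' x) x) (hB' : ∀ x, HasDerivAt B' (B'' x) x)
    (h0 : ∀ x, |B x| ≤ N₀) (h1 : ∀ x, |B' x| ≤ N₁) (h2 : ∀ x, |B'' x| ≤ N₂)
    (hBs : ∀ x, 2 < |x| → B x = 0) (hB0 : ∀ x, 0 ≤ B x)
    (hp : p.Prime) (hh : 0 < h) (hhL : h ≤ 1 / (32 * p)) (hhM : 1 ≤ h * M) (hhM2 : h ^ 2 * M ≤ 1)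
    (hc0 : ∀ n, 0 ≤ c n) (hA₁ : ∀ N : ℕ, 1 ≤ N → ∑ n ∈ Finset.Icc 1 N, c n ≤ A₁ * N)
    (hT : ∀ N : ℕ, |∑ n ∈ Finset.Icc 1 N, (c n - Λ n) / n| ≤ T₀)
    (hN : 1 ≤ N) (hNY : ⌊Real.sqrt (1 / (4 * h))⌋₊ ≤ N)
    (V : ℕ → ℕ → ℕ → ℝ)
    (hV : ∀ ℓ ℓ' n : ℕ, V ℓ ℓ' n = ∑ k' ∈ Finset.Icc 1 M,
      (∑ k ∈ Finset.Icc 1 M, B ((Real.log ((n : ℝ) * ℓ' * k' / ℓ) - Real.log k) / h) / Real.sqrt k)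
        / Real.sqrt k' / Real.sqrt n)
    (hcomb : (∑ n ∈ Finset.Icc 1 N, c n * V 1 1 n - ∑ n ∈ Finset.Icc 1 N, (Λ n : ℝ) * V 1 1 n)
      + (∑ n ∈ Finset.Icc 1 N, c n * V 1 p n - ∑ n ∈ Finset.Icc 1 N, (Λ n : ℝ) * V 1 p n)
      + (∑ n ∈ Finset.Icc 1 N, c n * V p 1 n - ∑ n ∈ Finset.Icc 1 N, (Λ n : ℝ) * V p 1 n)
      + (∑ n ∈ Finset.Icc 1 N, c n * V p p n - ∑ n ∈ Finset.Icc 1 N, (Λ n : ℝ) * V p p n)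
      ≤ V 1 1 1 + V 1 p 1 + V p 1 1 + V p p 1 + R) :
    B 0 * Real.sqrt p / 4 * Real.log (1 / (4 * h)) *
        ∑ n ∈ Finset.Icc 1 ⌊Real.sqrt (1 / (4 * h))⌋₊, (if p ∣ n then c n / n else 0)
      ≤ R + 4 * (B 0 * p * (1 + Real.log (1 / (4 * h))) + 8 * N₀ * p * h * M
              + (8 * ((N₀ + 2 * N₁ + N₂) * (96 + 192 * p) * p ^ 2) * p + 64 * N₀ * p ^ 2)
              + 8 * N₀ * p * h)
        + 4 * ((8 * ((N₀ + 2 * N₁ + N₂) * (96 + 192 * p) * p ^ 2) * p + 64 * N₀ * p ^ 2) *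
                ((A₁ + (Real.log 4 + 4)) * (1 + Real.log N))
              + 8 * N₀ * p * h * ((A₁ + (Real.log 4 + 4)) * N)
              + 8 * N₀ * p * h * M *
                ((2 * T₀ + 3 * (A₁ + (Real.log 4 + 4))) * p + (T₀ + (A₁ + (Real.log 4 + 4)))))
        + B 0 * (1 + Real.log (1 / (4 * h))) * (3 * T₀ + Real.sqrt p * (T₀ + 2)) := by
  have hp1 : 1 ≤ p := hp.one_lt.le
  have hp2 : 2 ≤ p := hp.two_le
  have hpR : (2 : ℝ) ≤ p := by exact_mod_cast hp2
  have hp0 : (0 : ℝ) < p := by linarith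
  have hT0 : 0 ≤ T₀ := (abs_nonneg _).trans (hT 0)
  have hB00 : 0 ≤ B 0 := hB0 0
  have hY8p : 8 * (p : ℝ) ≤ (1 / (4 * h)) := by
    rw [le_div_iff₀ (by positivity)]
    have := mul_le_mul_of_nonneg_left hhL (by positivity : (0 : ℝ) ≤ 32 * p)
    rw [show 32 * (p : ℝ) * (1 / (32 * p)) = 1 by field_simp] at this
    linarith
  have hY1 : 1 ≤ (1 / (4 * h)) := by linarith
  have hYp : 1 ≤ (1 / (4 * h)) / p := by rw [le_div_iff₀ hp0]; linarith
  have hlogY : 0 ≤ Real.log (1 / (4 * h)) := Real.log_nonneg hY1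
  have hlogYp : Real.log ((1 / (4 * h)) / p) ≤ Real.log (1 / (4 * h)) :=
    Real.log_le_log (by positivity) (div_le_self (by linarith) (by linarith))
  -- the four pair differences and the four norms
  have hd11 := pair_difference_bound (ℓ := 1) (ℓ' := 1) hB hB' h0 h1 h2 hBs hB0 hp1 le_rfl hp1 le_rfl
    hp1 hh hhL hhM hhM2 hc0 hA₁ hT hN
  have hd1p := pair_difference_bound (ℓ := 1) (ℓ' := p) hB hB' h0 h1 h2 hBs hB0 hp1 le_rfl hp1 hp1
    le_rfl hh hhL hhM hhM2 hc0 hA₁ hT hN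
  have hdp1 := pair_difference_bound (ℓ := p) (ℓ' := 1) hB hB' h0 h1 h2 hBs hB0 hp1 hp1 le_rfl le_rfl
    hp1 hh hhL hhM hhM2 hc0 hA₁ hT hN
  have hdpp := pair_difference_bound (ℓ := p) (ℓ' := p) hB hB' h0 h1 h2 hBs hB0 hp1 hp1 le_rfl hp1
    le_rfl hh hhL hhM hhM2 hc0 hA₁ hT hN
  have hn11 := pair_norm_bound (ℓ := 1) (ℓ' := 1) (M := M) hB hB' h0 h1 h2 hBs hB0 hp1 le_rfl hp1 le_rfl
    hp1 hh hhL hhM hhM2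
  have hn1p := pair_norm_bound (ℓ := 1) (ℓ' := p) (M := M) hB hB' h0 h1 h2 hBs hB0 hp1 le_rfl hp1 hp1
    le_rfl hh hhL hhM hhM2
  have hnp1 := pair_norm_bound (ℓ := p) (ℓ' := 1) (M := M) hB hB' h0 h1 h2 hBs hB0 hp1 hp1 le_rfl le_rfl
    hp1 hh hhL hhM hhM2
  have hnpp := pair_norm_bound (ℓ := p) (ℓ' := p) (M := M) hB hB' h0 h1 h2 hBs hB0 hp1 hp1 le_rfl hp1
    le_rfl hh hhL hhM hhM2
  -- the comb inequality in explicit form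
  simp only [hV] at hcomb
  -- the diagonal counts: trivial divisibility
  have hone : ∀ (n K : ℕ), ∑ k' ∈ Finset.Icc 1 K, (if 1 ∣ n * 1 * k' then 1 / (k' : ℝ) else 0)
      = ∑ k' ∈ Finset.Icc 1 K, 1 / (k' : ℝ) := fun n K ↦
    Finset.sum_congr rfl fun k' _ ↦ by rw [if_pos (one_dvd _)]
  have hone' : ∀ (n K : ℕ), ∑ k' ∈ Finset.Icc 1 K, (if 1 ∣ n * p * k' then 1 / (k' : ℝ) else 0)
      = ∑ k' ∈ Finset.Icc 1 K, 1 / (k' : ℝ) := fun n K ↦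
    Finset.sum_congr rfl fun k' _ ↦ by rw [if_pos (one_dvd _)]
  have hpp' : ∀ (n K : ℕ), ∑ k' ∈ Finset.Icc 1 K, (if p ∣ n * p * k' then 1 / (k' : ℝ) else 0)
      = ∑ k' ∈ Finset.Icc 1 K, 1 / (k' : ℝ) := fun n K ↦
    Finset.sum_congr rfl fun k' _ ↦ by rw [if_pos (dvd_mul_of_dvd_left (dvd_mul_left p n) k')]
  simp_rw [hone] at hd11
  simp_rw [hone'] at hd1p
  simp_rw [hpp'] at hdpp
  have hG11 := diag_trivial_bound (d := fun n ↦ c n - Λ n) (ℓ' := 1) hT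
    (by rw [Nat.cast_one, div_one]; exact hY1) N
  have hG1p := diag_trivial_bound (d := fun n ↦ c n - Λ n) (ℓ' := p) hT hYp N
  have e1 : 1 / (4 * h) / ((1 : ℕ) : ℝ) = 1 / (4 * h) := by rw [Nat.cast_one, div_one]
  rw [e1] at hG11
  have hG1p' : |∑ n ∈ Finset.Icc 1 N, (c n - Λ n) / n *
      ∑ k' ∈ Finset.Icc 1 ⌊1 / (4 * h) / ((n : ℝ) * p)⌋₊, (1 : ℝ) / k'| ≤ T₀ * (1 + Real.log (1 / (4 * h))) :=
    hG1p.trans (mul_le_mul_of_nonneg_left (by linarith) hT0)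
  -- the diagonal count of the pair `(p, 1)`
  have hK1 : ∀ n : ℕ, ⌊1 / (4 * h) / ((n : ℝ) * ((1 : ℕ) : ℝ))⌋₊ = ⌊(1 / (4 * h)) / n⌋₊ := fun n ↦ by
    rw [Nat.cast_one, mul_one]
  have hDp1 : ∀ n : ℕ,
      ∑ k' ∈ Finset.Icc 1 ⌊1 / (4 * h) / ((n : ℝ) * ((1 : ℕ) : ℝ))⌋₊,
          (if p ∣ n * 1 * k' then 1 / (k' : ℝ) else 0)
        = 1 / (p : ℝ) * ∑ j ∈ Finset.Icc 1 (⌊(1 / (4 * h)) / n⌋₊ / p), (1 : ℝ) / j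
          + (if p ∣ n then
              ∑ k' ∈ Finset.Icc 1 ⌊(1 / (4 * h)) / n⌋₊, (1 : ℝ) / k'
                - 1 / (p : ℝ) * ∑ j ∈ Finset.Icc 1 (⌊(1 / (4 * h)) / n⌋₊ / p), (1 : ℝ) / j
            else 0) := fun n ↦ by
    rw [hK1, diag_p1_decomp hp n]
  simp_rw [hDp1] at hdp1
  have hsplit : ∑ n ∈ Finset.Icc 1 N, (c n - Λ n) / n *
        (1 / (p : ℝ) * ∑ j ∈ Finset.Icc 1 (⌊(1 / (4 * h)) / n⌋₊ / p), (1 : ℝ) / j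
          + (if p ∣ n then
              ∑ k' ∈ Finset.Icc 1 ⌊(1 / (4 * h)) / n⌋₊, (1 : ℝ) / k'
                - 1 / (p : ℝ) * ∑ j ∈ Finset.Icc 1 (⌊(1 / (4 * h)) / n⌋₊ / p), (1 : ℝ) / j
            else 0))
      = 1 / (p : ℝ) * ∑ n ∈ Finset.Icc 1 N, (c n - Λ n) / n * ∑ j ∈ Finset.Icc 1 ⌊(1 / (4 * h)) / (p : ℝ) / n⌋₊, (1 : ℝ) / j
        + (∑ n ∈ Finset.Icc 1 N, c n / n *
              (if p ∣ n then
                ∑ k' ∈ Finset.Icc 1 ⌊(1 / (4 * h)) / n⌋₊, (1 : ℝ) / k'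
                  - 1 / (p : ℝ) * ∑ j ∈ Finset.Icc 1 (⌊(1 / (4 * h)) / n⌋₊ / p), (1 : ℝ) / j
              else 0)
            - ∑ n ∈ Finset.Icc 1 N, (Λ n : ℝ) / n *
              (if p ∣ n then
                ∑ k' ∈ Finset.Icc 1 ⌊(1 / (4 * h)) / n⌋₊, (1 : ℝ) / k'
                  - 1 / (p : ℝ) * ∑ j ∈ Finset.Icc 1 (⌊(1 / (4 * h)) / n⌋₊ / p), (1 : ℝ) / j
              else 0)) := by
    rw [Finset.mul_sum, ← Finset.sum_sub_distrib, ← Finset.sum_add_distrib]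
    refine Finset.sum_congr rfl fun n _ ↦ ?_
    rw [floor_div_p (1 / (4 * h)) n p]
    ring
  rw [hsplit] at hdp1
  have hGp1a := abs_sum_div_mul_harmonic_floor_le (d := fun n ↦ c n - Λ n) hT hYp N
  have hGp1a' : |∑ n ∈ Finset.Icc 1 N, (c n - Λ n) / n *
      ∑ j ∈ Finset.Icc 1 ⌊(1 / (4 * h)) / (p : ℝ) / n⌋₊, (1 : ℝ) / j| ≤ T₀ * (1 + Real.log (1 / (4 * h))) :=
    hGp1a.trans (mul_le_mul_of_nonneg_left (by linarith) hT0)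
  have hHc := hero_lower_bound hc0 hp2 hY1 hNY
  have hHL := vonMangoldt_part_le hp hY1 N
  -- coefficients
  have hs1 : Real.sqrt ((1 : ℕ) : ℝ) = 1 := by simp
  have hsp1 : 1 ≤ Real.sqrt (p : ℝ) := by
    rw [Real.le_sqrt' one_pos]; simp; linarith
  have hm11 : B 0 * (Real.sqrt ((1 : ℕ) : ℝ) / Real.sqrt ((1 : ℕ) : ℝ)) = B 0 := by rw [hs1]; simp
  have hm1p0 : 0 ≤ B 0 * (Real.sqrt ((1 : ℕ) : ℝ) / Real.sqrt (p : ℝ)) := by positivity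
  have hm1p1 : B 0 * (Real.sqrt ((1 : ℕ) : ℝ) / Real.sqrt (p : ℝ)) ≤ B 0 := by
    rw [hs1]
    exact mul_le_of_le_one_right hB00 ((div_le_one (by positivity)).2 hsp1)
  have hmpp : B 0 * (Real.sqrt (p : ℝ) / Real.sqrt (p : ℝ)) = B 0 := by
    rw [div_self (by positivity), mul_one]
  have hmp1 : B 0 * (Real.sqrt (p : ℝ) / Real.sqrt ((1 : ℕ) : ℝ)) = B 0 * Real.sqrt p := by
    rw [hs1, div_one]
  have hpinv0 : (0 : ℝ) ≤ 1 / p := by positivity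
  have hpinv1 : 1 / (p : ℝ) ≤ 1 := (div_le_one hp0).2 (by linarith)
  exact extraction_algebra hcomb hn11 hn1p hnp1 hnpp hd11 hd1p hdpp hdp1 hG11 hG1p' hG1p' hGp1a' hHc
    hHL hB00 hsp1 hpinv0 hpinv1 hT0 hlogY (by rw [hm11]; exact hB00) (by rw [hm11]) hm1p0 hm1p1
    (by rw [hmpp]; exact hB00) (by rw [hmpp]) hmp1

end Literature.NumberTheory.LFunctions
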